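import Summits.QuantumFields.QCD.Theorems.QuarksAsStableActionStableActionBridgeStubAbstractThermalRP
import Summits.QuantumFields.QCD.Theorems.QuarksAsStableActionStableActionBridgeStubInsertionLocal
import HarnessLib

/-!
# The thermal pairing of the smeared Θ-symmetrised observable is non-negative

Stub `stub_symAP_pairing_nonneg` of the line `Sketch` (reshape r3e, thermal re-basing) for the crux
`QuarksAsStableAction.StableActionBridge` (stmt-QuantumFields-9737).

At physical couplings (`β_k ≥ 0`, `m_f(k) > −1`, `L_k ≥ 1`) and for `n`-point test functions `G j` vanishing at
every lattice tuple with a member outside the lattice-time window `2 ≤ t ≤ L_k − 1`, the thermal OS pairing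
`⟨X · Θ_T X⟩_AP` of the smeared Θ-symmetrised observable `X = symSmearedObs sch k deg lab G` is real and
non-negative.  This is the landed abstract site-reflection positivity of the thermal functional
(`stub_abstractThermalRP`, file `…StubAbstractThermalRP`) applied on the odd torus `side k = 2 L_k + 1` with
`S := L_k`; its three hypotheses are supplied termwise:
* a term of `X` whose site tuple leaves the window has coefficient `G j (a_k y) = 0` (support hypothesis);
* inside the window every factor `renormInsertionSym sch k s (y l) U = (z a⁴ : ℂ) • (insertionSym U s (y l) − shift)`
  depends on the positive links `posLinks L_k` only and is a spectator of `negGens ∪ zeroGens`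
  (`stub_insertion_local`, file `…StubInsertionLocal`: the forward insertion at `1 ≤ t`, `t + 1 ≤ S`, the
  reflected-backward one at `2 ≤ t ≤ S`, both supports at `1 ≤ t ≤ S`), and subalgebras are closed under
  scalars, sums, differences and ordered products;
* every term is coefficient-regular (`coeffRegular_insertion` for the forward half; the `Θ_T`-image of the
  reflected-backward insertion is the same real scalar read in the reflected field for `glue`
  (`torusTheta_algebraMap`, `measurable_negReflect`) and a constant for the mesons).
Everything is proved; no named fact.  References: Osterwalder–Seiler 1978 §2; Montvay–Münster 1994 §4.2.3 (4.90),
(4.99).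
-/

noncomputable section

open scoped SchwartzMap BigOperators ComplexConjugate
open MeasureTheory
open Literature.MathematicalPhysics.QuantumFieldTheory Literature.MathematicalPhysics.QuantumLattice
open Literature.MathematicalPhysics.QuantumLattice.GrassmannAlgebra
open Literature.MathematicalPhysics.QuantumFieldTheory.WilsonSiteRP (measurable_negReflect)
open Literature.Probability.LatticeModels (box Site)

local notation "E4" => EuclideanSpace ℝ (Fin 4)
local notation "𝔾" => Matrix.specialUnitaryGroup (Fin 3) ℂ

namespace Summit.QuantumFields.QCD.Cruxes.StableActionBridge.Sketch

/-! ### The symmetrised insertions: locality, Grassmann support, regularity -/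

section InsertionSym

variable {Nf : ℕ}

/-- **The Θ-symmetrised insertion at `y` with `2 ≤ y₀`, `y₀ + 1 ≤ S` depends on the positive links only**
(forward half: `1 ≤ y₀`, `y₀ + 1 ≤ S`; reflected-backward half: `2 ≤ y₀ ≤ S`). -/
theorem insertionSym_congr {S : ℕ} (hS : 1 ≤ S) (s : QCDField Nf) {y : Site 4} (hy2 : 2 ≤ y 0)
    (hyS : y 0 + 1 ≤ S) {U U' : GaugeConfig 4 (2 * S + 1) 𝔾} (h : ∀ e ∈ posLinks S, U e = U' e) :
    insertionSym U s y = insertionSym U' s y := by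
  obtain ⟨h1, h2, -⟩ := stub_insertion_local S hS s y
  unfold insertionSym
  rw [h1 (by omega) hyS U U' h, h2 hy2 (by omega) U U' h]

/-- **The Θ-symmetrised insertion at `y` with `1 ≤ y₀ ≤ S` is a spectator of `negGens ∪ zeroGens`.** -/
theorem insertionSym_mem_spectator {S : ℕ} (hS : 1 ≤ S) (s : QCDField Nf) {y : Site 4} (hy1 : 1 ≤ y 0)
    (hyS : y 0 ≤ S) (U : GaugeConfig 4 (2 * S + 1) 𝔾) :
    insertionSym U s y ∈ spectatorSubalgebra ℂ (negGens Nf (2 * S + 1) ∪ zeroGens Nf (2 * S + 1)) := by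
  obtain ⟨hf, hb⟩ := (stub_insertion_local S hS s y).2.2 hy1 hyS U
  exact Subalgebra.smul_mem _ (Subalgebra.add_mem _ hf hb) _

variable {L : ℕ} [NeZero L]

/-- The `Θ_T`-image of the insertion read in the reflected field is coefficient-regular in the gauge field: for
`glue` it is the same real scalar (`Θ_T` conjugates scalars) read in the measurably reflected field, for the mesons
a constant. -/
theorem coeffRegular_torusTheta_insertion_negReflect (s : QCDField Nf) (y : Site 4) :
    CoeffRegular (fun U : GaugeConfig 4 L 𝔾 => torusTheta (insertion U.negReflect s y)) := by
  cases s with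
  | glue =>
    have he : (fun U : GaugeConfig 4 L 𝔾 => torusTheta (insertion U.negReflect (QCDField.glue : QCDField Nf) y)) =
        (fun V : GaugeConfig 4 L 𝔾 => insertion V (QCDField.glue : QCDField Nf) y) ∘ GaugeConfig.negReflect := by
      funext U
      simp only [Function.comp_apply, insertion, torusTheta_algebraMap, Complex.conj_ofReal]
    rw [he]
    exact (coeffRegular_insertion _ _).comp measurable_negReflect
  | pseudoRe f g =>
    simp only [insertion]
    exact coeffRegular_const _
  | pseudoIm f g =>
    simp only [insertion]
    exact coeffRegular_const _

/-- The Θ-symmetrised insertion is coefficient-regular in the gauge field. -/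
theorem coeffRegular_insertionSym (s : QCDField Nf) (y : Site 4) :
    CoeffRegular (fun U : GaugeConfig 4 L 𝔾 => insertionSym U s y) :=
  ((coeffRegular_insertion (L := L) s y).add
    (coeffRegular_torusTheta_insertion_negReflect (L := L) s (siteReflect y))).const_smul _

end InsertionSym

/-! ### The renormalised symmetrised insertions and the smeared observable of the scheme -/

section Scheme

variable {Nf : ℕ} (sch : QCDScheme Nf) (k : ℕ)

/-- The renormalised symmetrised insertion at `y` with `2 ≤ y₀`, `y₀ + 1 ≤ L_k` depends on the positive links of
the torus of side `2 L_k + 1` only. -/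
theorem renormInsertionSym_congr (hL : 1 ≤ sch.L k) (s : QCDField Nf) {y : Site 4} (hy2 : 2 ≤ y 0)
    (hyS : y 0 + 1 ≤ sch.L k) {U U' : GaugeConfig 4 (2 * sch.L k + 1) 𝔾}
    (h : ∀ e ∈ posLinks (sch.L k), U e = U' e) :
    renormInsertionSym sch k s y U = renormInsertionSym sch k s y U' :=
  congrArg (fun w : FermiAlg Nf (sch.side k) =>
      ((sch.z s k * sch.a k ^ 4 : ℝ) : ℂ) • (w - algebraMap ℂ _ ((sch.shift s k : ℝ) : ℂ)))
    (insertionSym_congr hL s hy2 hyS h)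

/-- The renormalised symmetrised insertion at `y` with `1 ≤ y₀ ≤ L_k` is a spectator of `negGens ∪ zeroGens`. -/
theorem renormInsertionSym_mem_spectator (hL : 1 ≤ sch.L k) (s : QCDField Nf) {y : Site 4} (hy1 : 1 ≤ y 0)
    (hyS : y 0 ≤ sch.L k) (U : GaugeConfig 4 (2 * sch.L k + 1) 𝔾) :
    renormInsertionSym sch k s y U ∈
      spectatorSubalgebra ℂ (negGens Nf (2 * sch.L k + 1) ∪ zeroGens Nf (2 * sch.L k + 1)) :=
  Subalgebra.smul_mem _ (Subalgebra.sub_mem _ (insertionSym_mem_spectator hL s hy1 hyS U)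
    (Subalgebra.algebraMap_mem _ _)) _

/-- The renormalised symmetrised insertion is coefficient-regular in the gauge field. -/
theorem coeffRegular_renormInsertionSym (s : QCDField Nf) (y : Site 4) :
    CoeffRegular (fun U : GaugeConfig 4 (sch.side k) 𝔾 => renormInsertionSym sch k s y U) := by
  -- adapted from coeffRegular_renormInsertion (Defs file)
  have h := ((coeffRegular_insertionSym (L := sch.side k) s y).add
    (coeffRegular_const (Ω := GaugeConfig 4 (sch.side k) 𝔾)
      (-(algebraMap ℂ (FermiAlg Nf (sch.side k)) ((sch.shift s k : ℝ) : ℂ))))).const_smul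
    ((sch.z s k * sch.a k ^ 4 : ℝ) : ℂ)
  simpa only [renormInsertionSym, sub_eq_add_neg] using h

variable {N : ℕ} (deg : Fin N → ℕ) (lab : (j : Fin N) → Fin (deg j) → QCDField Nf)
  (G : (j : Fin N) → 𝓢((Fin (deg j) → E4), ℂ))

/-- **The smeared Θ-symmetrised observable is coefficient-regular** (finite sums of scalar multiples of ordered
products of coefficient-regular factors). -/
theorem coeffRegular_symSmearedObs : CoeffRegular (symSmearedObs sch k deg lab G) := by
  have h : ∀ j : Fin N, CoeffRegular (fun U : GaugeConfig 4 (sch.side k) 𝔾 =>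
      ∑ y ∈ Fintype.piFinset (fun _ : Fin (deg j) => box 4 (sch.L k)),
        G j (fun l => sch.a k • siteToE (y l)) •
          (List.ofFn fun l => renormInsertionSym sch k (lab j l) (y l) U).prod) := fun j =>
    CoeffRegular.sum (Fintype.piFinset (fun _ : Fin (deg j) => box 4 (sch.L k))) fun y _ =>
      (coeffRegular_prod_ofFn fun l => coeffRegular_renormInsertionSym sch k (lab j l) (y l)).const_smul
        (G j (fun l => sch.a k • siteToE (y l)))
  exact CoeffRegular.sum Finset.univ fun j _ => h j

/-- **Locality of the smeared Θ-symmetrised observable**: when the `G j` vanish at every lattice tuple with a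
member outside the window `2 ≤ t ≤ L_k − 1`, `symSmearedObs` depends on the positive links only. -/
theorem symSmearedObs_congr (hL : 1 ≤ sch.L k)
    (hsupp : ∀ (j : Fin N) (y : Fin (deg j) → Site 4), (∃ l, ¬ (2 ≤ y l 0 ∧ y l 0 + 1 ≤ (sch.L k : ℤ))) →
      G j (fun l => sch.a k • siteToE (y l)) = 0)
    {U U' : GaugeConfig 4 (2 * sch.L k + 1) 𝔾} (h : ∀ e ∈ posLinks (sch.L k), U e = U' e) :
    symSmearedObs sch k deg lab G U = symSmearedObs sch k deg lab G U' := by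
  unfold symSmearedObs
  refine Finset.sum_congr rfl fun j _ => Finset.sum_congr rfl fun y _ => ?_
  by_cases hw : ∃ l, ¬ (2 ≤ y l 0 ∧ y l 0 + 1 ≤ (sch.L k : ℤ))
  · rw [hsupp j y hw, zero_smul, zero_smul]
  · push Not at hw
    exact congrArg (fun f : Fin (deg j) → FermiAlg Nf (sch.side k) =>
        G j (fun l => sch.a k • siteToE (y l)) • (List.ofFn f).prod)
      (funext fun l => renormInsertionSym_congr sch k hL (lab j l) (hw l).1 (hw l).2 h)

/-- **Grassmann support of the smeared Θ-symmetrised observable**: under the same support hypothesis,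
`symSmearedObs` is a spectator of `negGens ∪ zeroGens` on the torus of side `sch.side k = 2 L_k + 1`. -/
theorem symSmearedObs_mem_spectator (hL : 1 ≤ sch.L k)
    (hsupp : ∀ (j : Fin N) (y : Fin (deg j) → Site 4), (∃ l, ¬ (2 ≤ y l 0 ∧ y l 0 + 1 ≤ (sch.L k : ℤ))) →
      G j (fun l => sch.a k • siteToE (y l)) = 0)
    (U : GaugeConfig 4 (sch.side k) 𝔾) :
    symSmearedObs sch k deg lab G U ∈
      spectatorSubalgebra ℂ (negGens Nf (sch.side k) ∪ zeroGens Nf (sch.side k)) := by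
  -- stated on the torus of side `sch.side k` (definitionally `2 L_k + 1`) so that the subalgebra lemmas
  -- elaborate at one side; `renormInsertionSym_mem_spectator` is used across the definitional seam by `exact`
  unfold symSmearedObs
  refine Subalgebra.sum_mem _ fun j _ => Subalgebra.sum_mem _ fun y _ => ?_
  by_cases hw : ∃ l, ¬ (2 ≤ y l 0 ∧ y l 0 + 1 ≤ (sch.L k : ℤ))
  · rw [hsupp j y hw, zero_smul]
    exact Subalgebra.zero_mem _
  · push Not at hw
    refine Subalgebra.smul_mem _ (Subalgebra.list_prod_mem _ (List.forall_mem_ofFn_iff.2 fun l => ?_)) _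
    have h1 := (hw l).1
    have h2 := (hw l).2
    exact renormInsertionSym_mem_spectator sch k hL (lab j l) (by omega) (by omega) U

end Scheme

/-! ### The registered stub -/

/-- **Stub (r3e, wave 3; the thermal pairing of the smeared observable is non-negative).**  At physical couplings
(`β_k ≥ 0`, `m_f(k) > −1`, `L_k ≥ 1`) and for test functions vanishing at lattice times outside `2 ≤ t ≤ L_k − 1`, the
observable `symSmearedObs` depends on the positive links only, lives off the negative-time and slice generators and is
coefficient-regular (`stub_insertion_local` for both halves of the symmetrised insertions; sums, scalar multiples and
ordered products), so `stub_abstractThermalRP` applies on the odd torus `side k = 2 L_k + 1`. -/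
theorem stub_symAP_pairing_nonneg : ∀ {Nf : ℕ} (sch : QCDScheme Nf) (k : ℕ), 0 ≤ sch.β k → (∀ fl, -1 < sch.mq fl k) →
    1 ≤ sch.L k → ∀ {N : ℕ} (deg : Fin N → ℕ) (lab : (j : Fin N) → Fin (deg j) → QCDField Nf)
      (G : (j : Fin N) → 𝓢((Fin (deg j) → E4), ℂ)),
      (∀ (j : Fin N) (y : Fin (deg j) → Site 4), (∃ l, ¬ (2 ≤ y l 0 ∧ y l 0 + 1 ≤ (sch.L k : ℤ))) →
        G j (fun l => sch.a k • siteToE (y l)) = 0) →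
      0 ≤ (qcdTorusExpectAP (sch.β k) (sch.side k) (fun fl => sch.mq fl k)
          (fun U => symSmearedObs sch k deg lab G U * torusTheta (symSmearedObs sch k deg lab G U.negReflect))).re ∧
        (qcdTorusExpectAP (sch.β k) (sch.side k) (fun fl => sch.mq fl k)
          (fun U => symSmearedObs sch k deg lab G U * torusTheta (symSmearedObs sch k deg lab G U.negReflect))).im = 0 := by
  intro Nf sch k hβ hmq hL N deg lab G hsupp
  exact stub_abstractThermalRP (sch.L k) hL (sch.β k) hβ (fun fl => sch.mq fl k) hmq (symSmearedObs sch k deg lab G)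
    (fun _ _ h => symSmearedObs_congr sch k deg lab G hL hsupp h)
    (fun U => symSmearedObs_mem_spectator sch k deg lab G hL hsupp U) (coeffRegular_symSmearedObs sch k deg lab G)

end Summit.QuantumFields.QCD.Cruxes.StableActionBridge.Sketch

end
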